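import Summits.NavierStokesRegularity.OSWSelfSimilar.SheetRFrameCentre
import Summits.NavierStokesRegularity.OSWSelfSimilar.SheetRCentreOfRecordData
import HarnessLib

/-!
# SHEET-ℝ frame: THE CENTRE OF RECORD as a kernel object — `Ω̄ = Σ_{n≤767} d_n·(1 + cos θ)sin nθ + α₂·L²T₂`, `L = 8`, and `IsCentre 8 Ω̄ Ω̄₁ H₀`

HONEST FRAMING (cell ns-blowup GROUP B / zone Z3, cases Z3-SR-CERT / Z3-SR-SPEC; 1-D MODEL certificate frame (viscous gCLM/OSW sheet on the line at
`(a, c_l, ε) = (1/5, 1/2, 1)`); not Euler/NS; «violates: none — MODEL»).  With the data of `SheetRCentreOfRecordData` (the 767 exact frame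
coefficients `d_n` and `α₂` of cert-1's centre of record, `centre_L8_refit_rational.json` c4de65e13d80c930, re-encoded offline from the sine form
through `b_k = d_k + ½(d_{k−1} + d_{k+1})`, consistency ⇔ `s₁ = 0`) and the generic theorem `SheetRFrameCentre.isCentre_frameCentre`:

* `centreOfRecord = frameCentre 8 767 centreCoeff α₂`, `centreOfRecordDeriv` its derivative (`hasDerivAt_centreOfRecord`), both smooth;
* **`isCentre_centreOfRecord : IsCentre 8 centreOfRecord centreOfRecordDeriv centreH₀`**, `centreH₀ = 2Σ|d_i| + 6|α₂|/π` — hypothesis-ledger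
  row #1 of the Z3-SR chain (`SheetRSpectrumCertifiedProfile.certifiedProfile_word`'s `hc`, `SheetRCertificateCoercivity.modelBlowup_of_pointwise_certificate`'s
  `hc`) is now a KERNEL FACT about a DEFINED function, and row #2 (`ContDiff ℝ 1 Ω̄₁`) is `contDiff_centreOfRecordDeriv`;
* `hilbertTransform_centreOfRecord` — the closed form of `HΩ̄` the engines evaluate (`−Σ d_i(1 + cos θ)cos((i+1)θ) + α₂·64·HT₂`).
So the interval sentences of record ((C1) `hC1`, residual `hG/hηB`, (S1) `hS1`) are henceforth statements about `centreOfRecord`.  Definitions: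
`centreOfRecord`, `centreOfRecordDeriv`, `centreH₀`; no named fact.  WHAT THIS IS NOT: not NS; no interval sentence is proved; the
equality with the JSON's sine form is an offline exact re-encoding (documented in the data file), not a Lean theorem; «a typed centre is not a
certified profile».
-/

noncomputable section

namespace Summit.NavierStokesRegularity.OSWSelfSimilar
namespace SheetRCentreOfRecord

open _root_.Real SheetRFrameCentre SheetRCertificateAssembly

/-- **THE CENTRE OF RECORD** `Ω̄ = Σ_{i<767} d_{i+1}·e_{i+1} + α₂·8²·T₂` (`L = 8`). [folklore] -/
def centreOfRecord : ℝ → ℝ := frameCentre 8 767 centreCoeff centreAlpha2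

/-- Its derivative `Ω̄₁`. [folklore] -/
def centreOfRecordDeriv : ℝ → ℝ := frameCentreDeriv 8 767 centreCoeff centreAlpha2

/-- The Hilbert-transform bound `H₀ = 2Σ|d_i| + 6|α₂|/π`. [folklore] -/
def centreH₀ : ℝ := 2 * (∑ i ∈ Finset.range 767, |centreCoeff i|) + 6 * |centreAlpha2| / π

/-- **THE CENTRE OF RECORD IS A CENTRE**: `IsCentre 8 Ω̄ Ω̄₁ H₀` — primitive form `Ω̄ = ∫₀Ω̄₁`, odd, `∫(64 + ξ²)Ω̄² < ∞`, `∫(64 + ξ²)Ω̄₁² < ∞`,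
`|HΩ̄| ≤ H₀`.  (Hypothesis-ledger row #1 of the Z3-SR chain as a kernel fact about a defined function.) [folklore] -/
theorem isCentre_centreOfRecord : IsCentre 8 centreOfRecord centreOfRecordDeriv centreH₀ :=
  isCentre_frameCentre (by norm_num) 767 centreCoeff centreAlpha2

/-- `Ω̄₁ ∈ C¹` (indeed `C^k` for every `k`; hypothesis-ledger row #2). [folklore] -/
theorem contDiff_centreOfRecordDeriv {k : WithTop ℕ∞} : ContDiff ℝ k centreOfRecordDeriv :=
  contDiff_frameCentreDeriv (by norm_num) 767 centreCoeff centreAlpha2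

/-- `Ω̄₁` is the derivative of `Ω̄`. [folklore] -/
theorem hasDerivAt_centreOfRecord (ξ : ℝ) : HasDerivAt centreOfRecord (centreOfRecordDeriv ξ) ξ :=
  hasDerivAt_frameCentre (by norm_num) 767 centreCoeff centreAlpha2 ξ

/-- `Ω̄` is smooth. [folklore] -/
theorem contDiff_centreOfRecord {k : WithTop ℕ∞} : ContDiff ℝ k centreOfRecord :=
  contDiff_frameCentre (by norm_num) 767 centreCoeff centreAlpha2

/-- `Ω̄` is odd. [folklore] -/
theorem centreOfRecord_neg (ξ : ℝ) : centreOfRecord (-ξ) = -centreOfRecord ξ :=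
  frameCentre_neg 767 centreCoeff centreAlpha2 ξ

/-- The closed form of `HΩ̄`: `−Σ d_i (1 + cos θ)cos((i+1)θ) + α₂·64·HT₂` (`θ = 2arctan(x/8)`). [folklore] -/
theorem hilbertTransform_centreOfRecord (x : ℝ) :
    Literature.Analysis.Fourier.hilbertTransform centreOfRecord x =
      -(∑ i ∈ Finset.range 767, centreCoeff i * ((1 + cos (2 * arctan (x / 8))) * cos ((i + 1 : ℕ) * (2 * arctan (x / 8)))))
        + centreAlpha2 * ((8:ℝ) ^ 2 * (2 / π * (x * Real.arsinh (x / 8) / (((8:ℝ) ^ 2 + x ^ 2) * √((8:ℝ) ^ 2 + x ^ 2))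
          - ((8:ℝ) ^ 2 + x ^ 2)⁻¹))) :=
  hilbertTransform_frameCentre (by norm_num) 767 centreCoeff centreAlpha2 x

end SheetRCentreOfRecord
end Summit.NavierStokesRegularity.OSWSelfSimilar

end
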